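import Literature.Geometry.Riemannian.ConstantCurvatureRicci
import Literature.Geometry.Riemannian.HyperbolicBallCompactification
import Literature.Geometry.Riemannian.RoundSphere
import Literature.Geometry.Riemannian.RiemannianDistance
import Literature.Geometry.Lorentzian.Hypersurface
import Literature.Geometry.Lorentzian.IsometryProofs
import Literature.Topology.FourManifolds.ClosedBallTangent
import Literature.Topology.FourManifolds.ClosedBallSmoothEmbeddings
import Literature.Topology.FourManifolds.InteriorSmoothEmbedding
import Literature.Topology.FourManifolds.ImmersionCriterion
import Literature.Geometry.Manifold.OpenSubmanifoldMFDeriv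

/-!
# Crux `PEFillNearRound` (stmt-SmoothPoincare4-7997), line `Sketch`, helper piece `helper_rf_conformal` of
# `helper_roundFilled` (the round `S⁴` bounds hyperbolic `5`-space = route item
# `EinsteinBulk.RoundSphereBoundsHyperbolicSpace`, the base point of `stub_peFillStandard`)

Conformal compactness `j^*ḡ = (ρ ∘ j)² g_ℍ`: the Euclidean metric pulled back along the compactification map `x = ξ/(1+τ)` is `ρ²` times the hyperbolic metric (`Hyperboloid.inner_ballMapDeriv_eq`), read through the manifold differentials.
-/

noncomputable section

-- the prescribed namespace `Summit.<P>.<Sub>.…` duplicates `SmoothPoincare4` (P = Sub)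
set_option linter.dupNamespace false

open scoped Manifold ContDiff Topology RealInnerProductSpace
open Set Function Metric Bundle TopologicalSpace
open Literature.Geometry.Lorentzian Literature.Geometry.Lorentzian.PseudoRiemannianMetric
open Literature.Geometry.Riemannian Literature.Topology.FourManifolds
open Literature.Geometry.Manifold

namespace Summit.SmoothPoincare4.SmoothPoincare4.Cruxes.PEFillNearRound.RoundFilled

/-- **Chain rule behind `j^*ḡ = ρ² g_ℍ`.** For any `C^∞` map `j : ℍ⁵ → 𝔻⁵` whose composite
with the inclusion `𝔻⁵ ↪ ℝ⁵` is the compactification map `ballMap` (read on the open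
submanifold `⊤ ⊆ ℝ⁵`), the ambient image `dι (dj v)` of `dj v` is `d(ballMap) v`
(`dι = closedBallCoeDeriv`, `dι ∘ dj = d(ι ∘ j) = d(ballMap ∘ val) = d(ballMap) ∘ id` by the chain
rule and uniqueness of manifold derivatives), so a metric `gb` on `𝔻⁵` with
`gb_p(a, b) = ⟪dι_p a, dι_p b⟫` pulls back along `j` to `⟪d(ballMap) v, d(ballMap) w⟫ = ρ² G`
(`Hyperboloid.inner_ballMapDeriv_eq`). [cite: Lee2018, Thm. 3.7 (c)] -/
private theorem inner_mfderiv_eq_of_coe_eq_ballMap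
    (gb : Bundle.ContMDiffRiemannianMetric (𝓡∂ 5) 2 (EuclideanSpace ℝ (Fin 5))
      (TangentSpace (𝓡∂ 5) : ↥(Metric.closedBall (0 : EuclideanSpace ℝ (Fin 5)) 1) → Type _))
    (hgb : ∀ (p : ↥(Metric.closedBall (0 : EuclideanSpace ℝ (Fin 5)) 1))
      (a b : TangentSpace (𝓡∂ 5) p),
      gb.inner p a b = inner ℝ (closedBallCoeDeriv p a) (closedBallCoeDeriv p b))
    (j : ↥(⊤ : TopologicalSpace.Opens (EuclideanSpace ℝ (Fin 5))) →
      ↥(Metric.closedBall (0 : EuclideanSpace ℝ (Fin 5)) 1))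
    (hj : ∀ u, (j u : EuclideanSpace ℝ (Fin 5)) =
      Hyperboloid.ballMap (u : EuclideanSpace ℝ (Fin 5)))
    (hjs : ContMDiff (𝓡 5) (𝓡∂ 5) ∞ j)
    (x : ↥(⊤ : TopologicalSpace.Opens (EuclideanSpace ℝ (Fin 5)))) (v w : TangentSpace (𝓡 5) x) :
    gb.inner (j x) (mfderiv (𝓡 5) (𝓡∂ 5) j x v) (mfderiv (𝓡 5) (𝓡∂ 5) j x w) =
      Hyperboloid.ballDefFn (Hyperboloid.ballMap (x : EuclideanSpace ℝ (Fin 5))) ^ 2 *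
        ((Hyperboloid.metric (⊤ : TopologicalSpace.Opens (EuclideanSpace ℝ (Fin 5)))).toContMDiffRiemannianMetric
          Hyperboloid.isRiemannian_metric).inner x v w := by
  -- `dj` and `dι` as manifold derivatives, and their composite `d(ι ∘ j)`
  have h1 : HasMFDerivAt (𝓡 5) (𝓡∂ 5) j x (mfderiv (𝓡 5) (𝓡∂ 5) j x) :=
    ((hjs x).mdifferentiableAt (by simp)).hasMFDerivAt
  have h3 : HasMFDerivAt (𝓡∂ 5) 𝓘(ℝ, EuclideanSpace ℝ (Fin 5)) Subtype.val (j x)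
      (closedBallCoeDeriv (j x) : EuclideanSpace ℝ (Fin 5) →L[ℝ] EuclideanSpace ℝ (Fin 5)) :=
    hasMFDerivAt_coe_closedBall (j x)
  have h13 : HasMFDerivAt (𝓡 5) 𝓘(ℝ, EuclideanSpace ℝ (Fin 5)) (Subtype.val ∘ j) x
      ((closedBallCoeDeriv (j x) : EuclideanSpace ℝ (Fin 5) →L[ℝ] EuclideanSpace ℝ (Fin 5)).comp
        (mfderiv (𝓡 5) (𝓡∂ 5) j x)) :=
    h3.comp x h1
  -- `d(ballMap ∘ val) = d(ballMap) ∘ id` on the open submanifold `⊤ ⊆ ℝ⁵`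
  have h4 : HasMFDerivAt (𝓡 5) (𝓡 5)
      (Subtype.val : ↥(⊤ : TopologicalSpace.Opens (EuclideanSpace ℝ (Fin 5))) →
        EuclideanSpace ℝ (Fin 5)) x
      (ContinuousLinearMap.id ℝ (EuclideanSpace ℝ (Fin 5))) :=
    OpenSubmanifold.hasMFDerivAt_subtype_val x
  have h5 : HasMFDerivAt 𝓘(ℝ, EuclideanSpace ℝ (Fin 5)) 𝓘(ℝ, EuclideanSpace ℝ (Fin 5))
      (Hyperboloid.ballMap : EuclideanSpace ℝ (Fin 5) → EuclideanSpace ℝ (Fin 5))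
      (x : EuclideanSpace ℝ (Fin 5))
      (fderiv ℝ (Hyperboloid.ballMap : EuclideanSpace ℝ (Fin 5) → EuclideanSpace ℝ (Fin 5))
        (x : EuclideanSpace ℝ (Fin 5))) :=
    (((Hyperboloid.contDiff_ballMap (V := EuclideanSpace ℝ (Fin 5))).differentiable
      (by simp)) _).hasFDerivAt.hasMFDerivAt
  have h45 : HasMFDerivAt (𝓡 5) 𝓘(ℝ, EuclideanSpace ℝ (Fin 5))
      ((Hyperboloid.ballMap : EuclideanSpace ℝ (Fin 5) → EuclideanSpace ℝ (Fin 5)) ∘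
        (Subtype.val : ↥(⊤ : TopologicalSpace.Opens (EuclideanSpace ℝ (Fin 5))) →
          EuclideanSpace ℝ (Fin 5))) x
      ((fderiv ℝ (Hyperboloid.ballMap : EuclideanSpace ℝ (Fin 5) → EuclideanSpace ℝ (Fin 5))
        (x : EuclideanSpace ℝ (Fin 5))).comp
        (ContinuousLinearMap.id ℝ (EuclideanSpace ℝ (Fin 5)))) :=
    h5.comp x h4
  have hfun : (Subtype.val ∘ j) =
      (Hyperboloid.ballMap : EuclideanSpace ℝ (Fin 5) → EuclideanSpace ℝ (Fin 5)) ∘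
        (Subtype.val : ↥(⊤ : TopologicalSpace.Opens (EuclideanSpace ℝ (Fin 5))) →
          EuclideanSpace ℝ (Fin 5)) :=
    funext fun u => hj u
  rw [hfun] at h13
  -- uniqueness of the manifold derivative: `dι (dj a) = d(ballMap) a`
  have heq := hasMFDerivAt_unique h13 h45
  have hpt : ∀ a : EuclideanSpace ℝ (Fin 5), closedBallCoeDeriv (j x)
      (mfderiv (𝓡 5) (𝓡∂ 5) j x a) =
      fderiv ℝ (Hyperboloid.ballMap : EuclideanSpace ℝ (Fin 5) → EuclideanSpace ℝ (Fin 5))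
        (x : EuclideanSpace ℝ (Fin 5)) a :=
    fun a => DFunLike.congr_fun heq a
  rw [hgb, hpt v, hpt w, toContMDiffRiemannianMetric_inner, Hyperboloid.metric_val]
  exact Hyperboloid.inner_ballMapDeriv_eq (x : EuclideanSpace ℝ (Fin 5)) v w

/-- **`j^*ḡ = ρ² g⁺`** for `g⁺ = g_ℍ` on the graph chart and `ḡ = |dx|²` on `𝔻⁵` (Lee 2018, Thm. 3.7 (c): `(π⁻¹)^*ğ = 4|dx|²/(1-|x|²)²`). -/
theorem helper_rf_conformal :
    ∀ gb : Bundle.ContMDiffRiemannianMetric (𝓡∂ 5) 2 (EuclideanSpace ℝ (Fin 5)) (TangentSpace (𝓡∂ 5) : ↥(Metric.closedBall (0 : EuclideanSpace ℝ (Fin 5)) 1) → Type _), (∀ (p : ↥(Metric.closedBall (0 : EuclideanSpace ℝ (Fin 5)) 1)) (a b : TangentSpace (𝓡∂ 5) p), gb.inner p a b = inner ℝ (Literature.Topology.FourManifolds.closedBallCoeDeriv p a) (Literature.Topology.FourManifolds.closedBallCoeDeriv p b)) → ∀ (x : ↥(⊤ : TopologicalSpace.Opens (EuclideanSpace ℝ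 (Fin 5)))) (v w : TangentSpace (𝓡 5) x), gb.inner ((fun u : ↥(⊤ : TopologicalSpace.Opens (EuclideanSpace ℝ (Fin 5))) => (⟨Literature.Geometry.Riemannian.Hyperboloid.ballMap (u : (EuclideanSpace ℝ (Fin 5))), mem_closedBall_zero_iff.2 (Literature.Geometry.Riemannian.Hyperboloid.norm_ballMap_lt_one (u : (EuclideanSpace ℝ (Fin 5)))).le⟩ : ↥(Metric.closedBall (0 : EuclideanSpace ℝ (Fin 5)) 1))) x) (mfderiv (𝓡 5) (𝓡∂ 5) (fun u : ↥(⊤ : TopologicalSpace.Opens (EuclideanSpace ℝ (Fin 5))) => (⟨Literature.Geometry.Riemannian.Hyperboloid.ballMap (u : (EuclideanSpace ℝ (Fin 5))), mem_closedBall_zero_iff.2 (Literature.Geometry.Riemannian.Hyperboloid.norm_ballMap_lt_one (u : (EuclideanSpace ℝ (Fin 5)))).le⟩ : ↥(Metric.closedBall (0 : EuclideanSpace ℝ (Fin 5)) 1))) x v) (mfderiv (𝓡 5) (𝓡∂ 5) (fun u : ↥(⊤ : TopologicalSpace.Opens (EuclideanSpace ℝ (Fin 5))) => (⟨Literature.Geometry.Riemannian.Hyperboloid.ballMap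 (u : (EuclideanSpace ℝ (Fin 5))), mem_closedBall_zero_iff.2 (Literature.Geometry.Riemannian.Hyperboloid.norm_ballMap_lt_one (u : (EuclideanSpace ℝ (Fin 5)))).le⟩ : ↥(Metric.closedBall (0 : EuclideanSpace ℝ (Fin 5)) 1))) x w) = Literature.Geometry.Riemannian.Hyperboloid.ballDefFn (Literature.Geometry.Riemannian.Hyperboloid.ballMap (x : (EuclideanSpace ℝ (Fin 5)))) ^ 2 * ((Literature.Geometry.Riemannian.Hyperboloid.metric (⊤ : TopologicalSpace.Opens (EuclideanSpace ℝ (Fin 5)))).toContMDiffRiemannianMetric Literature.Geometry.Riemannian.Hyperboloid.isRiemannian_metric).inner x v w := by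
  intro gb hgb x v w
  exact inner_mfderiv_eq_of_coe_eq_ballMap gb hgb _ (fun _ => rfl)
    ((Hyperboloid.contDiff_ballMap.contMDiff.comp contMDiff_subtype_val).codRestrict_closedBall
      (fun u : ↥(⊤ : TopologicalSpace.Opens (EuclideanSpace ℝ (Fin 5))) =>
        mem_closedBall_zero_iff.2
          (Hyperboloid.norm_ballMap_lt_one (u : EuclideanSpace ℝ (Fin 5))).le)) x v w

end Summit.SmoothPoincare4.SmoothPoincare4.Cruxes.PEFillNearRound.RoundFilled

end
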